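import Summits.Ventures.HSemireg.ObstructionLocusBlockArrangement

/-!
# Venture HSemireg — (S5) OBSTRUCTION LOCUS away from secant type, XXIV: the BLOCK STRUCTURE AT A POINT of a (GEN)
# arrangement — EXT-NOTE §6.0 «LOCAL MODELS»: `S_t(q) = {k : q_k = t_k}` are pairwise disjoint under (GEN), and
# `q ∈ W + t ⟺ |S_t(q)| ≥ 2`

HONEST FRAMING.  Companion of files XV–XXIII (cell `pub-hsemireg`, track «S4-PUSH» (ii), seat s4-prove-2; vocabulary
and honest framing as there).  EXT-NOTE §6.0: «At `q ∈ X` put `S_t(q) := {k : q_k = t_k}`; by (GEN) the `S_t(q)`,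
`t ∈ T`, are pairwise disjoint.  With local parameters `u_k = x_k − q_k`, étale-locally `(X, Z)_q ≅ (𝔸ⁿ, M)_0`,
`M = M(S_1, …, S_r)` (blocks = the `S_t(q)` of size `≥ 2`; `r` = #translates through `q`)».  This file is the
COMBINATORIAL half of that sentence, for any coordinate type `G` (the points of `E`): the coincidence sets of a point
`q ∈ Gⁿ` with the translates `t ∈ T` are pairwise disjoint as soon as distinct translates differ in EVERY coordinate
((GEN)), the translates THROUGH `q` (those with `q ∈ W + t`, `W = {≥ 2 coordinates vanish}`) are exactly those with
`|S_t(q)| ≥ 2`, and they assemble into a block structure `Blocks.ofPoint` (file XVI's `Blocks`) — the input of the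
multi-block local lemma (file XIX) and of its grading (files XXII/XXIII) at the point `q`.  The ÉTALE-LOCAL
identification `(X, Z_T)_q ≅ (𝔸ⁿ, M(Blocks.ofPoint))_0` itself, sheafification and completion stay PROSE / BINDER,
as does everything global; nothing here constructs a variety or a sheaf; nothing here says that HC / HC_CM / HC_AV
holds; no Literature fact is declared or used.

* `coincidence q t = S_t(q)`; `disjoint_coincidence` ((GEN) ⇒ pairwise disjoint); `mem_translate_iff`
  (`(∃ a ≠ b, q_a = t_a ∧ q_b = t_b) ⟺ 2 ≤ |S_t(q)|`); `Blocks.ofPoint` (blocks = the `S_t(q)` with `|S_t(q)| ≥ 2`,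
  indexed by the translates through `q`), `Blocks.ofPoint_S`.
References (dictionary only): EXT-NOTE.md §6.0 (GEN) and LOCAL MODELS; BRANCH-SHIFT-NOTE.md («generic torsion
translates»); STRUCTURE.md §2 (S5)/(S-B), hypothesis (H-arr).
-/

open Finset

namespace Summit.Ventures.HSemireg.ObstructionLocus.BlockModel

variable {n : ℕ} {G : Type*} [DecidableEq G]

/-- The COINCIDENCE SET `S_t(q) = {k : q_k = t_k}` of the point `q` with the translate `W + t`. -/
def coincidence (q t : Fin n → G) : Finset (Fin n) := univ.filter fun k => q k = t k

/-- Membership in `S_t(q)`. -/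
theorem mem_coincidence {q t : Fin n → G} {k : Fin n} : k ∈ coincidence q t ↔ q k = t k := by
  simp [coincidence]

/-- **(GEN) ⇒ the coincidence sets of distinct translates are disjoint**: if `t_k ≠ t'_k` for every `k` then
`S_t(q) ∩ S_{t'}(q) = ∅`. -/
theorem disjoint_coincidence (q : Fin n → G) {t t' : Fin n → G} (h : ∀ k, t k ≠ t' k) :
    Disjoint (coincidence q t) (coincidence q t') := by
  rw [Finset.disjoint_left]
  intro k hk hk'
  exact h k ((mem_coincidence.1 hk).symm.trans (mem_coincidence.1 hk'))

/-- **`q ∈ W + t ⟺ |S_t(q)| ≥ 2`**: `q` lies on the translate by `t` of `W = {≥ 2 coordinates vanish} = ⋃_{a<b} B_ab`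
iff at least two coordinates of `q` and `t` coincide. -/
theorem mem_translate_iff (q t : Fin n → G) :
    (∃ a b : Fin n, a ≠ b ∧ q a = t a ∧ q b = t b) ↔ 2 ≤ (coincidence q t).card := by
  rw [show (2 ≤ (coincidence q t).card) = (1 < (coincidence q t).card) from rfl, Finset.one_lt_card_iff]
  simp only [mem_coincidence]
  constructor
  · rintro ⟨a, b, hab, ha, hb⟩
    exact ⟨a, b, ha, hb, hab⟩
  · rintro ⟨a, b, ha, hb, hab⟩
    exact ⟨a, b, hab, ha, hb⟩

/-- The translates THROUGH `q`: `t ∈ T` with `|S_t(q)| ≥ 2`, i.e. `q ∈ W + t`. -/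
def through (q : Fin n → G) (T : Finset (Fin n → G)) : Finset (Fin n → G) :=
  T.filter fun t => 2 ≤ (coincidence q t).card

/-- Membership in `through q T`. -/
theorem mem_through {q : Fin n → G} {T : Finset (Fin n → G)} {t : Fin n → G} :
    t ∈ through q T ↔ t ∈ T ∧ 2 ≤ (coincidence q t).card := Finset.mem_filter

/-- **THE BLOCK STRUCTURE AT A POINT (EXT-NOTE §6.0 LOCAL MODELS).**  For a finite set `T` of translation vectors
satisfying (GEN) — distinct `t, t' ∈ T` differ in EVERY coordinate — and any point `q`, the coincidence sets `S_t(q)`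
of the translates through `q` form a block structure on `[n]` (file XVI's `Blocks`): pairwise disjoint, each of size
`≥ 2`.  Its block model `M(S_t(q) : t through q)` is EXT-NOTE's étale-local model of `(X, Z_T)` at `q` (that
identification stays prose). -/
def Blocks.ofPoint (q : Fin n → G) (T : Finset (Fin n → G))
    (hGEN : ∀ t ∈ T, ∀ t' ∈ T, t ≠ t' → ∀ k, t k ≠ t' k) : Blocks ↥(through q T) n where
  S t := coincidence q t.1
  disjoint i j hij := disjoint_coincidence q (hGEN i.1 (mem_through.1 i.2).1 j.1 (mem_through.1 j.2).1
    (fun h => hij (Subtype.ext h)))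
  nonempty i := Finset.card_pos.1 (lt_of_lt_of_le Nat.zero_lt_two (mem_through.1 i.2).2)

/-- Its blocks are the coincidence sets. -/
theorem Blocks.ofPoint_S (q : Fin n → G) (T : Finset (Fin n → G))
    (hGEN : ∀ t ∈ T, ∀ t' ∈ T, t ≠ t' → ∀ k, t k ≠ t' k) (t : ↥(through q T)) :
    (Blocks.ofPoint q T hGEN).S t = coincidence q t.1 := rfl

/-- **At most `n / 2` translates pass through any point** under (GEN): `2 · #(through q T) ≤ n` (the blocks are
disjoint subsets of `[n]` of size `≥ 2`; EXT-NOTE §6.B(c): `𝓔xt^q = 0` for `q > r`, and `r ≤ n/2`). -/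
theorem two_mul_card_through_le (q : Fin n → G) (T : Finset (Fin n → G))
    (hGEN : ∀ t ∈ T, ∀ t' ∈ T, t ≠ t' → ∀ k, t k ≠ t' k) : 2 * (through q T).card ≤ n := by
  have h1 : ((through q T).biUnion (coincidence q)).card = ∑ t ∈ through q T, (coincidence q t).card :=
    Finset.card_biUnion fun t ht t' ht' hne =>
      disjoint_coincidence q (hGEN t (mem_through.1 ht).1 t' (mem_through.1 ht').1 hne)
  have h2 : ((through q T).biUnion (coincidence q)).card ≤ n :=
    (Finset.card_le_univ _).trans (by rw [Fintype.card_fin])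
  have h3 : (through q T).card • 2 ≤ ∑ t ∈ through q T, (coincidence q t).card :=
    Finset.card_nsmul_le_sum _ _ _ fun t ht => (mem_through.1 ht).2
  rw [smul_eq_mul, mul_comm] at h3
  omega

end Summit.Ventures.HSemireg.ObstructionLocus.BlockModel
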